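import Summits.ValiantsHypothesis.ValiantsHypothesis.Theorems.LacunarySymmetroidMatrixDescartesFiniteSectorSumMasksHigherFour

/-!
# `MatrixDescartes` — line «finite»: `σ(11,5) = 1094` finite core, SLICES (2,8) of the kernel enumeration (part E)

HONEST FRAMING.  Object-search cell `pub-symmetroid`, seat val-sym-door-p5 g10 (generators of val-sym-door-p5 g8/g9 VERBATIM, m-tables extended to m ≤ 19; fold binders typed `(x acc : ℕ)` — same elaborated terms, fast elaboration).  HELPER of the crux item `stmt-ValiantsHypothesis-18050` with NO closure claim and no
statement about pencils: SLICES (two smallest positive values fixed) of the pruned nested enumeration behind `HypRootLawAt 11 5 1094` (assembled with the sieve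
transfer in `…FiniteSectorSectorCeilingElevenFive`), each decided in the kernel with the `11`-fold sum set as an iterated shift-form bitmask (`…FiniteSectorSumMasksHigherFour`).
The whole enumeration has 256043 live prefixes.  Nothing here bears on the crux, the doors, or `VP ≠ VNP`.
[folklore] Finite enumeration (postage-stamp numbers `n(11,·)`); no citation is load-bearing.
-/

-- `Summit.ValiantsHypothesis.ValiantsHypothesis.…` repeats a component by the D-0017 layout
-- (single-conjunct summit), which the `dupNamespace` linter flags; the name is mandated.
set_option linter.dupNamespace false

namespace Summit.ValiantsHypothesis.ValiantsHypothesis.Theorems.LacunarySymmetroidMatrixDescartes.FiniteSector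

set_option synthInstance.maxSize 2000000 in
set_option synthInstance.maxHeartbeats 2000000 in
set_option maxHeartbeats 4000000 in
/-- **Finite core of `σ(11,5) = 1094`, slice `(a = 2, b = 8)`** (11154 live prefixes; pruned nested enumeration over the remaining sorted
values `< 1098`, `11`-fold sums as shift-form bitmasks, `decide` in the kernel): prefix chains alive below the next value and the whole chain reaching `1093` force
`1095` NOT an `11`-fold sum and `1094`, `1096` not BOTH. [folklore] -/
theorem sectorCheck_eleven_five_s28 :
    ∀ c ∈ List.range 1098, (8 < c ∧ ((List.foldr (fun (x acc : ℕ) => acc ||| (List.foldr (fun (x acc : ℕ) => acc ||| (List.foldr (fun (x acc : ℕ) => acc ||| (List.foldr (fun (x acc : ℕ) => acc ||| (List.foldr (fun (x acc : ℕ) => acc ||| (List.foldr (fun (x acc : ℕ) => acc ||| (List.foldr (fun (x acc : ℕ) => acc ||| (List.foldr (fun (x acc : ℕ) => acc ||| (List.foldr (fun (x acc : ℕ) => acc ||| (List.foldr (fun (x acc : ℕ) => acc ||| (List.foldr (fun (y acc : ℕ) => acc ||| 2 ^ y) 0 [0, 2, 8]) * 2 ^ x) 0 [0, 2, 8]) *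 2 ^ x) 0 [0, 2, 8]) * 2 ^ x) 0 [0, 2, 8]) * 2 ^ x) 0 [0, 2, 8]) * 2 ^ x) 0 [0, 2, 8]) * 2 ^ x) 0 [0, 2, 8]) * 2 ^ x) 0 [0, 2, 8]) * 2 ^ x) 0 [0, 2, 8]) * 2 ^ x) 0 [0, 2, 8]) * 2 ^ x) 0 [0, 2, 8] ||| List.foldr (fun (x acc : ℕ) => acc ||| (List.foldr (fun (x acc : ℕ) => acc ||| (List.foldr (fun (x acc : ℕ) => acc ||| (List.foldr (fun (x acc : ℕ) => acc ||| (List.foldr (fun (x acc : ℕ) => acc ||| (List.foldr (fun (x acc : ℕ) => acc ||| (List.foldr (fun (x acc : ℕ) => acc ||| (List.foldr (fun (x acc : ℕ) => acc ||| (List.foldr (fun (x acc : ℕ) => acc ||| (List.foldr (fun (x acc : ℕ) => acc ||| (List.foldr (fun (y acc : ℕ) => acc ||| 2 ^ y) 0 [0, 2, 8]) * 2 ^ x) 0 [0, 2, 8]) * 2 ^ x) 0 [0, 2, 8]) * 2 ^ x) 0 [0, 2, 8]) * 2 ^ x) 0 [0, 2, 8]) * 2 ^ x) 0 [0, 2,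 8]) * 2 ^ x) 0 [0, 2, 8]) * 2 ^ x) 0 [0, 2, 8]) * 2 ^ x) 0 [0, 2, 8]) * 2 ^ x) 0 [0, 2, 8]) * 2 ^ x) 0 [0, 2, 8] / 2) % 2 ^ (min 1094 (c - 1)) = 2 ^ (min 1094 (c - 1)) - 1)) →
    ∀ e ∈ List.range 1098, (c < e ∧ ((List.foldr (fun (x acc : ℕ) => acc ||| (List.foldr (fun (x acc : ℕ) => acc ||| (List.foldr (fun (x acc : ℕ) => acc ||| (List.foldr (fun (x acc : ℕ) => acc ||| (List.foldr (fun (x acc : ℕ) => acc ||| (List.foldr (fun (x acc : ℕ) => acc ||| (List.foldr (fun (x acc : ℕ) => acc ||| (List.foldr (fun (x acc : ℕ) => acc ||| (List.foldr (fun (x acc : ℕ) => acc ||| (List.foldr (fun (x acc : ℕ) => acc ||| (List.foldr (fun (y acc : ℕ) => acc ||| 2 ^ y) 0 [0, 2, 8, c]) * 2 ^ x) 0 [0, 2, 8, c]) * 2 ^ x) 0 [0, 2, 8, c]) * 2 ^ x) 0 [0, 2, 8, c]) * 2 ^ x) 0 [0, 2, 8, c]) * 2 ^ x) 0 [0, 2,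 8, c]) * 2 ^ x) 0 [0, 2, 8, c]) * 2 ^ x) 0 [0, 2, 8, c]) * 2 ^ x) 0 [0, 2, 8, c]) * 2 ^ x) 0 [0, 2, 8, c]) * 2 ^ x) 0 [0, 2, 8, c] ||| List.foldr (fun (x acc : ℕ) => acc ||| (List.foldr (fun (x acc : ℕ) => acc ||| (List.foldr (fun (x acc : ℕ) => acc ||| (List.foldr (fun (x acc : ℕ) => acc ||| (List.foldr (fun (x acc : ℕ) => acc ||| (List.foldr (fun (x acc : ℕ) => acc ||| (List.foldr (fun (x acc : ℕ) => acc ||| (List.foldr (fun (x acc : ℕ) => acc ||| (List.foldr (fun (x acc : ℕ) => acc ||| (List.foldr (fun (x acc : ℕ) => acc ||| (List.foldr (fun (y acc : ℕ) => acc ||| 2 ^ y) 0 [0, 2, 8, c]) * 2 ^ x) 0 [0, 2, 8, c]) * 2 ^ x) 0 [0, 2, 8, c]) * 2 ^ x) 0 [0, 2, 8, c]) * 2 ^ x) 0 [0, 2, 8, c]) * 2 ^ x) 0 [0, 2, 8, c]) * 2 ^ x) 0 [0, 2, 8, c]) * 2 ^ x) 0 [0, 2, 8, c]) * 2 ^ x)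 0 [0, 2, 8, c]) * 2 ^ x) 0 [0, 2, 8, c]) * 2 ^ x) 0 [0, 2, 8, c] / 2) % 2 ^ (min 1094 (e - 1)) = 2 ^ (min 1094 (e - 1)) - 1)) →
    (((List.foldr (fun (x acc : ℕ) => acc ||| (List.foldr (fun (x acc : ℕ) => acc ||| (List.foldr (fun (x acc : ℕ) => acc ||| (List.foldr (fun (x acc : ℕ) => acc ||| (List.foldr (fun (x acc : ℕ) => acc ||| (List.foldr (fun (x acc : ℕ) => acc ||| (List.foldr (fun (x acc : ℕ) => acc ||| (List.foldr (fun (x acc : ℕ) => acc ||| (List.foldr (fun (x acc : ℕ) => acc ||| (List.foldr (fun (x acc : ℕ) => acc ||| (List.foldr (fun (y acc : ℕ) => acc ||| 2 ^ y) 0 [0, 2, 8, c, e]) * 2 ^ x) 0 [0, 2, 8, c, e]) * 2 ^ x) 0 [0, 2, 8, c, e]) * 2 ^ x) 0 [0, 2, 8, c, e]) * 2 ^ x) 0 [0, 2, 8, c, e]) * 2 ^ x) 0 [0, 2, 8, c, e]) * 2 ^ x) 0 [0, 2, 8, c, e]) * 2 ^ x) 0 [0, 2, 8, c, e]) * 2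 ^ x) 0 [0, 2, 8, c, e]) * 2 ^ x) 0 [0, 2, 8, c, e]) * 2 ^ x) 0 [0, 2, 8, c, e] ||| List.foldr (fun (x acc : ℕ) => acc ||| (List.foldr (fun (x acc : ℕ) => acc ||| (List.foldr (fun (x acc : ℕ) => acc ||| (List.foldr (fun (x acc : ℕ) => acc ||| (List.foldr (fun (x acc : ℕ) => acc ||| (List.foldr (fun (x acc : ℕ) => acc ||| (List.foldr (fun (x acc : ℕ) => acc ||| (List.foldr (fun (x acc : ℕ) => acc ||| (List.foldr (fun (x acc : ℕ) => acc ||| (List.foldr (fun (x acc : ℕ) => acc ||| (List.foldr (fun (y acc : ℕ) => acc ||| 2 ^ y) 0 [0, 2, 8, c, e]) * 2 ^ x) 0 [0, 2, 8, c, e]) * 2 ^ x) 0 [0, 2, 8, c, e]) * 2 ^ x) 0 [0, 2, 8, c, e]) * 2 ^ x) 0 [0, 2, 8, c, e]) * 2 ^ x) 0 [0, 2, 8, c, e]) * 2 ^ x) 0 [0, 2, 8, c, e]) * 2 ^ x) 0 [0, 2, 8, c, e]) * 2 ^ x) 0 [0, 2, 8, c, e]) * 2 ^ x) 0 [0, 2,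 8, c, e]) * 2 ^ x) 0 [0, 2, 8, c, e] / 2) % 2 ^ 1094 = 2 ^ 1094 - 1) →
      ((List.foldr (fun (x acc : ℕ) => acc ||| (List.foldr (fun (x acc : ℕ) => acc ||| (List.foldr (fun (x acc : ℕ) => acc ||| (List.foldr (fun (x acc : ℕ) => acc ||| (List.foldr (fun (x acc : ℕ) => acc ||| (List.foldr (fun (x acc : ℕ) => acc ||| (List.foldr (fun (x acc : ℕ) => acc ||| (List.foldr (fun (x acc : ℕ) => acc ||| (List.foldr (fun (x acc : ℕ) => acc ||| (List.foldr (fun (x acc : ℕ) => acc ||| (List.foldr (fun (y acc : ℕ) => acc ||| 2 ^ y) 0 [0, 2, 8, c, e]) * 2 ^ x) 0 [0, 2, 8, c, e]) * 2 ^ x) 0 [0, 2, 8, c, e]) * 2 ^ x) 0 [0, 2, 8, c, e]) * 2 ^ x) 0 [0, 2, 8, c, e]) * 2 ^ x) 0 [0, 2, 8, c, e]) * 2 ^ x) 0 [0, 2, 8, c, e]) * 2 ^ x) 0 [0, 2, 8, c, e]) * 2 ^ x) 0 [0, 2, 8, c, e]) * 2 ^ x) 0 [0, 2, 8, c, e])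 * 2 ^ x) 0 [0, 2, 8, c, e]).testBit 1095 = false ∧ ((List.foldr (fun (x acc : ℕ) => acc ||| (List.foldr (fun (x acc : ℕ) => acc ||| (List.foldr (fun (x acc : ℕ) => acc ||| (List.foldr (fun (x acc : ℕ) => acc ||| (List.foldr (fun (x acc : ℕ) => acc ||| (List.foldr (fun (x acc : ℕ) => acc ||| (List.foldr (fun (x acc : ℕ) => acc ||| (List.foldr (fun (x acc : ℕ) => acc ||| (List.foldr (fun (x acc : ℕ) => acc ||| (List.foldr (fun (x acc : ℕ) => acc ||| (List.foldr (fun (y acc : ℕ) => acc ||| 2 ^ y) 0 [0, 2, 8, c, e]) * 2 ^ x) 0 [0, 2, 8, c, e]) * 2 ^ x) 0 [0, 2, 8, c, e]) * 2 ^ x) 0 [0, 2, 8, c, e]) * 2 ^ x) 0 [0, 2, 8, c, e]) * 2 ^ x) 0 [0, 2, 8, c, e]) * 2 ^ x) 0 [0, 2, 8, c, e]) * 2 ^ x) 0 [0, 2, 8, c, e]) * 2 ^ x) 0 [0, 2, 8, c, e]) * 2 ^ x) 0 [0, 2, 8, c, e]) * 2 ^ x) 0 [0, 2, 8, c, e]).testBit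 1094 = false ∨ (List.foldr (fun (x acc : ℕ) => acc ||| (List.foldr (fun (x acc : ℕ) => acc ||| (List.foldr (fun (x acc : ℕ) => acc ||| (List.foldr (fun (x acc : ℕ) => acc ||| (List.foldr (fun (x acc : ℕ) => acc ||| (List.foldr (fun (x acc : ℕ) => acc ||| (List.foldr (fun (x acc : ℕ) => acc ||| (List.foldr (fun (x acc : ℕ) => acc ||| (List.foldr (fun (x acc : ℕ) => acc ||| (List.foldr (fun (x acc : ℕ) => acc ||| (List.foldr (fun (y acc : ℕ) => acc ||| 2 ^ y) 0 [0, 2, 8, c, e]) * 2 ^ x) 0 [0, 2, 8, c, e]) * 2 ^ x) 0 [0, 2, 8, c, e]) * 2 ^ x) 0 [0, 2, 8, c, e]) * 2 ^ x) 0 [0, 2, 8, c, e]) * 2 ^ x) 0 [0, 2, 8, c, e]) * 2 ^ x) 0 [0, 2, 8, c, e]) * 2 ^ x) 0 [0, 2, 8, c, e]) * 2 ^ x) 0 [0, 2, 8, c, e]) * 2 ^ x) 0 [0, 2, 8, c, e]) * 2 ^ x) 0 [0, 2, 8, c, e]).testBit 1096 = false))) := by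
  decide +kernel

end Summit.ValiantsHypothesis.ValiantsHypothesis.Theorems.LacunarySymmetroidMatrixDescartes.FiniteSector
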